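import Literature.Geometry.Riemannian.GeodesicPolarCoordinates
import HarnessLib

/-!
# The half segment inequality at a point under `Ric ≥ n - 1`

The segment inequality of Cheeger–Colding (J. Cheeger, T. H. Colding, *Lower bounds on Ricci
curvature and the almost rigidity of warped products*, Ann. of Math. 144 (1996), Thm. 2.11) bounds
`∫_{A×B} ℱ_e(x, y)` — `ℱ_e(x, y)` the integral of a nonnegative function `e` along the minimal
geodesic from `x` to `y` — by `c(n, r) r (Vol A + Vol B) ∫ e`; it is the device by which the `L²`
Hessian estimate (`ColdingHessianEstimate.lean`) is integrated along almost all minimal segments in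
the modern form of Colding's `L²`-Toponogov theorem (Colding 1997, *Aspects*, Thm. 1.1: "compare
[Colding 1996b; Cheeger and Colding 1996] for later versions"), replacing the Liouville measure of
Colding 1996a. Its proof splits each segment into two halves; the half adjacent to `y` is
controlled from the base point `x` alone, by polar coordinates at `x` and Bishop's monotonicity of
the Jacobian of `exp_x` along rays ("`𝒜(t)/𝒜(s) ≤ (sn(t)/sn(s))^{n-1}`").

We PROVE this **half segment inequality at a point**, `κ = 1`, in the tangent space at `p`
(geodesic coordinates `y = exp_p(T v)`, `T : ℝᵐ ≃ T_pM` a linear isometry, `v` in the preimage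
`T⁻¹ID(p)` of the injectivity domain, where `s ↦ exp_p(T(s v))`, `s ∈ [0, 1]`, is the minimal
segment from `p` to `y`): for a measurable `e : M → [0, ∞]` and `R ≤ π/2`,

  `∫_{v ∈ T⁻¹ID(p), ‖v‖ ≤ R} 𝒥(v) (∫_{1/2}^{1} e(exp_p(T(s v))) ds) dv
      ≤ 2^{m-1} ∫_{v ∈ T⁻¹ID(p), ‖v‖ ≤ R} 𝒥(v) e(exp_p(T v)) dv`

(`lintegral_jacobian_mul_lintegral_halfSegment_le`), `𝒥` the Gram–Jacobian of `exp_p ∘ T`, i.e.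
(by `lintegral_riemVolume_eq_lintegral_injectivityDomain`) `dVol_g(y) = 𝒥(v) dv` and the right
side is `2^{m-1} ∫_{B̄_R(p)} e dVol_g`. Proof: Tonelli in `(v, s)`; for fixed `s ∈ [1/2, 1]` the
substitution `w = s v` in `ℝᵐ` (`Measure.map_addHaar_smul`) costs `s^{-m}`, the preimage of the
injectivity domain is star-shaped, and along the ray Bishop's cross inequality
(`sqrt_det_gram_mfderiv_expMap_cross_le_of_unit`, `BishopGromovVolumeComparison.lean` §1) with
`sin t ≤ 2 sin u` for `t/2 ≤ u ≤ t ≤ π/2` gives `𝒥(v) ≤ 2^{m-1} s^{m-1} 𝒥(s v)`.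

The right side is converted to `2^{m-1} ∫_{B̄_R(p)} e dVol_g`
(`setLIntegral_closedBall_eq_lintegral_jacobian_mul`,
`lintegral_jacobian_mul_lintegral_halfSegment_le_setLIntegral_closedBall`) by integration in
geodesic coordinates (`GeodesicPolarCoordinates.lean`).

No definitions, no named facts (D-0026).

## References

* J. Cheeger, T. H. Colding, *Lower bounds on Ricci curvature and the almost rigidity of warped
  products*, Ann. of Math. (2) 144 (1996), 189–237, Thm. 2.11 (segment inequality) and its
  proof. [CheegerColding1996]
* T. H. Colding, *Aspects of Ricci curvature*, in: Comparison Geometry, MSRI Publ. 30 (1997),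
  Thm. 1.1 and the remark following it (p. 88). [Colding1997Aspects]
* I. Chavel, *Riemannian Geometry: A Modern Introduction*, 2nd ed., CUP 2006, Prop. III.4.1,
  Thm. III.4.3. [Chavel2006]
-/

noncomputable section

open Bundle Set Function Filter MeasureTheory Manifold
open scoped Manifold ContDiff Topology ENNReal NNReal

namespace Literature.Geometry.Riemannian

open Lorentzian Lorentzian.PseudoRiemannianMetric

variable {m : ℕ} {M : Type*} [TopologicalSpace M] [T2Space M] [SecondCountableTopology M]
  [ChartedSpace (EuclideanSpace ℝ (Fin m)) M] [IsManifold (𝓡 m) ∞ M] [T3Space M]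
  [MeasurableSpace M] [BorelSpace M]
  (g : PseudoRiemannianMetric (𝓡 m) ∞ (EuclideanSpace ℝ (Fin m)) (TangentSpace (𝓡 m) : M → Type _))
  [ConnectedSpace M] [g.HasLeviCivita]

/-- **Lebesgue integral under a dilation of `ℝᵐ`**: `∫⁻ f(r x) dx = |r^{-m}| ∫⁻ f`, the
`lintegral` form of Mathlib's `Measure.map_addHaar_smul`. [folklore] -/
theorem lintegral_comp_smul_euclidean {f : EuclideanSpace ℝ (Fin m) → ℝ≥0∞} (hf : Measurable f)
    {r : ℝ} (hr : r ≠ 0) :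
    ∫⁻ x, f (r • x) = ENNReal.ofReal |(r ^ m)⁻¹| * ∫⁻ x, f x := by
  have h := lintegral_map (μ := (volume : Measure (EuclideanSpace ℝ (Fin m)))) hf
    (measurable_const_smul r)
  rw [Measure.map_addHaar_smul volume hr, lintegral_smul_measure, finrank_euclideanSpace_fin,
    smul_eq_mul] at h
  exact h.symm

omit [SecondCountableTopology M] [T3Space M] [ConnectedSpace M] in
set_option maxHeartbeats 800000 in
-- the assembled proof (framing, ray comparison, dilation, Tonelli) is long
/-- **The half segment inequality at a point, `Ric ≥ m - 1`** (the base-point half of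
Cheeger–Colding 1996, Thm. 2.11, via Chavel 2006, Prop. III.4.1). Let `(M, g)` be a
Riemannian `m`-manifold, `m ≥ 2`, modelled on `ℝᵐ`, with compact closed distance balls and
`Ric ≥ (m - 1) g`; `p ∈ M`, `T : ℝᵐ ≃ (T_pM, g_p)` a linear isometry, `𝒥` the Gram–Jacobian of
`exp_p ∘ T`, `D_R = {v : T v ∈ ID(p), ‖v‖ ≤ R}` with `R ≤ π/2`, and `e : M → [0, ∞]` measurable.
Then
`∫⁻_{D_R} 𝒥(v) (∫⁻_{s ∈ [1/2, 1]} e(exp_p(T(s v))) ds) dv ≤ 2^{m-1} ∫⁻_{D_R} 𝒥(v) e(exp_p(T v)) dv`: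
the average of `e` over the half of the minimal segment `s ↦ exp_p(T(sv))` adjacent to its
endpoint, integrated against `dVol_g = 𝒥 dv` over the ball, is at most `2^{m-1} ∫_{B̄_R(p)} e`.
[cite: CheegerColding1996, Thm. 2.11 (proof)] [cite: Chavel2006, Prop. III.4.1] -/
theorem lintegral_jacobian_mul_lintegral_halfSegment_le (hg : g.IsRiemannian) (hm : 2 ≤ m)
    (hcpl : ∀ (x : M) (r : ℝ≥0), IsCompact {y : M | g.edist hg x y ≤ r})
    (hRic : ∀ (x : M) (w : TangentSpace (𝓡 m) x), ((m : ℝ) - 1) * g.val x w w ≤ g.ricci x w w)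
    (p : M) (T : EuclideanSpace ℝ (Fin m) ≃L[ℝ] EuclideanSpace ℝ (Fin m))
    (hT : ∀ v, g.val p (T v) (T v) = ‖v‖ ^ 2) {e : M → ℝ≥0∞} (he : Measurable e)
    {R : ℝ} (hRπ : R ≤ Real.pi / 2) :
    ∫⁻ v in {v : EuclideanSpace ℝ (Fin m) |
        (T v : TangentSpace (𝓡 m) p) ∈ injectivityDomain g hg p ∧ ‖v‖ ≤ R},
      ENNReal.ofReal (Real.sqrt (Matrix.det (Matrix.of fun i j : Fin m ↦
          g.val (riemannianExpMap g p (T v))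
            (mfderiv 𝓘(ℝ, EuclideanSpace ℝ (Fin m)) (𝓡 m)
              (fun v : EuclideanSpace ℝ (Fin m) ↦ riemannianExpMap g p (T v)) v
              (EuclideanSpace.single i (1 : ℝ)))
            (mfderiv 𝓘(ℝ, EuclideanSpace ℝ (Fin m)) (𝓡 m)
              (fun v : EuclideanSpace ℝ (Fin m) ↦ riemannianExpMap g p (T v)) v
              (EuclideanSpace.single j (1 : ℝ)))))) *
        ∫⁻ s in Icc (1 / 2 : ℝ) 1, e (riemannianExpMap g p (T (s • v))) ≤
      2 ^ (m - 1) * ∫⁻ v in {v : EuclideanSpace ℝ (Fin m) |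
        (T v : TangentSpace (𝓡 m) p) ∈ injectivityDomain g hg p ∧ ‖v‖ ≤ R},
      ENNReal.ofReal (Real.sqrt (Matrix.det (Matrix.of fun i j : Fin m ↦
          g.val (riemannianExpMap g p (T v))
            (mfderiv 𝓘(ℝ, EuclideanSpace ℝ (Fin m)) (𝓡 m)
              (fun v : EuclideanSpace ℝ (Fin m) ↦ riemannianExpMap g p (T v)) v
              (EuclideanSpace.single i (1 : ℝ)))
            (mfderiv 𝓘(ℝ, EuclideanSpace ℝ (Fin m)) (𝓡 m)
              (fun v : EuclideanSpace ℝ (Fin m) ↦ riemannianExpMap g p (T v)) v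
              (EuclideanSpace.single j (1 : ℝ)))))) *
        e (riemannianExpMap g p (T v)) := by
  obtain ⟨k, rfl⟩ : ∃ k, m = k + 1 := ⟨m - 1, by omega⟩
  rw [Nat.add_sub_cancel]
  -- §0 the Levi-Civita connection of the smooth metric is `C¹` and `C^∞`, and complete
  have hk1' : ((1 : ℕ∞) : ℕ∞ω) + 1 ≤ (∞ : ℕ∞ω) := by
    rw [show ((1 : ℕ∞) : ℕ∞ω) + 1 = 2 by norm_num]
    exact WithTop.coe_le_coe.2 le_top
  haveI : CovariantDerivative.ContMDiffCovariantDerivative g.leviCivita 1 :=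
    ⟨g.isLocallyContMDiff_leviCivita_holds 1 hk1' univ isOpen_univ⟩
  haveI : CovariantDerivative.ContMDiffCovariantDerivative g.leviCivita (∞ : ℕ∞ω) :=
    ⟨g.isLocallyContMDiff_leviCivita_holds ⊤ (le_of_eq rfl) univ isOpen_univ⟩
  haveI : Fact (1 ≤ (∞ : ℕ∞ω)) := ⟨by exact_mod_cast le_top⟩
  have hc : IsGeodesicallyComplete g.leviCivita :=
    isGeodesicallyComplete_of_isCompact_closedBall hg hcpl
  have hfinE : Module.finrank ℝ (EuclideanSpace ℝ (Fin (k + 1))) = k + 1 :=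
    finrank_euclideanSpace_fin
  have hRic' : ∀ (x : M) (w : TangentSpace (𝓡 (k + 1)) x),
      ((Module.finrank ℝ (EuclideanSpace ℝ (Fin (k + 1))) : ℝ) - 1) * g.val x w w ≤
        g.leviCivita.ricci x w w := by
    intro x w
    rw [hfinE]
    exact hRic x w
  -- §1 the framing `T`, the basis `bx = T e`, minimality along `T (c • v)`
  have hT_inj : Injective T := T.injective
  have hmin_congr : ∀ (w w' : EuclideanSpace ℝ (Fin (k + 1))) (b : ℝ), w = w' →
      (IsMinimizingUpTo g hg p w b ↔ IsMinimizingUpTo g hg p w' b) := by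
    intro w w' b h
    subst h
    exact Iff.rfl
  have hTsmul : ∀ (c : ℝ), 0 < c → ∀ (v : EuclideanSpace ℝ (Fin (k + 1))) (b : ℝ),
      (IsMinimizingUpTo g hg p (T (c • v)) b ↔ IsMinimizingUpTo g hg p (T v) (c * b)) := by
    intro c hc0 v b
    exact (hmin_congr _ _ b (map_smul T c v)).trans
      (isMinimizingUpTo_smul_iff hg hc p (T v) hc0 b)
  set bx : Module.Basis (Fin (k + 1)) ℝ (EuclideanSpace ℝ (Fin (k + 1))) :=
    (EuclideanSpace.basisFun (Fin (k + 1)) ℝ).toBasis.map T.toLinearEquiv with hbx_def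
  have hT_single : ∀ i, T (EuclideanSpace.single i (1 : ℝ)) = bx i := fun i ↦ by
    rw [hbx_def, Module.Basis.map_apply, OrthonormalBasis.coe_toBasis,
      EuclideanSpace.basisFun_apply]
    rfl
  -- §2 `F = exp_p ∘ T`, its Gram–Jacobian `J`, and `J` through `exp_p` on the basis `bx`
  set F : EuclideanSpace ℝ (Fin (k + 1)) → M := fun v ↦ riemannianExpMap g p (T v) with hF_def
  have hexp : ContMDiff 𝓘(ℝ, EuclideanSpace ℝ (Fin (k + 1))) (𝓡 (k + 1)) 1
      (fun u : EuclideanSpace ℝ (Fin (k + 1)) ↦ riemannianExpMap g p u) :=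
    (contMDiff_riemannianExpMap g le_rfl hc p).of_le (WithTop.coe_le_coe.mpr le_top)
  have hF1 : ContMDiff 𝓘(ℝ, EuclideanSpace ℝ (Fin (k + 1))) (𝓡 (k + 1)) 1 F :=
    hexp.comp (T : EuclideanSpace ℝ (Fin (k + 1)) →L[ℝ] EuclideanSpace ℝ (Fin (k + 1))).contMDiff
  have hFm : Measurable F := hF1.continuous.measurable
  set J : EuclideanSpace ℝ (Fin (k + 1)) → ℝ := fun v ↦ Real.sqrt (Matrix.det (Matrix.of
    fun i j : Fin (k + 1) ↦ g.val (F v)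
      (mfderiv 𝓘(ℝ, EuclideanSpace ℝ (Fin (k + 1))) (𝓡 (k + 1)) F v (EuclideanSpace.single i (1 : ℝ)))
      (mfderiv 𝓘(ℝ, EuclideanSpace ℝ (Fin (k + 1))) (𝓡 (k + 1)) F v (EuclideanSpace.single j (1 : ℝ)))))
    with hJ_def
  have hJcont : Continuous J := continuous_sqrt_det_gram_mfderiv g hF1
  have hJ0 : ∀ v, 0 ≤ J v := fun v ↦ Real.sqrt_nonneg _
  have hJm : Measurable fun v ↦ ENNReal.ofReal (J v) :=
    ENNReal.measurable_ofReal.comp hJcont.measurable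
  have hchain : ∀ v i, mfderiv 𝓘(ℝ, EuclideanSpace ℝ (Fin (k + 1))) (𝓡 (k + 1)) F v
      (EuclideanSpace.single i (1 : ℝ)) =
      mfderiv 𝓘(ℝ, EuclideanSpace ℝ (Fin (k + 1))) (𝓡 (k + 1))
        (fun u : EuclideanSpace ℝ (Fin (k + 1)) ↦ riemannianExpMap g p u) (T v) (bx i) := by
    intro v i
    have h1 : HasMFDerivAt 𝓘(ℝ, EuclideanSpace ℝ (Fin (k + 1))) (𝓡 (k + 1))
        (fun u : EuclideanSpace ℝ (Fin (k + 1)) ↦ riemannianExpMap g p u) (T v)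
        (mfderiv 𝓘(ℝ, EuclideanSpace ℝ (Fin (k + 1))) (𝓡 (k + 1))
          (fun u : EuclideanSpace ℝ (Fin (k + 1)) ↦ riemannianExpMap g p u) (T v)) :=
      ((hexp (T v)).mdifferentiableAt one_ne_zero).hasMFDerivAt
    have h2 : HasMFDerivAt 𝓘(ℝ, EuclideanSpace ℝ (Fin (k + 1))) (𝓡 (k + 1)) F v
        ((mfderiv 𝓘(ℝ, EuclideanSpace ℝ (Fin (k + 1))) (𝓡 (k + 1))
          (fun u : EuclideanSpace ℝ (Fin (k + 1)) ↦ riemannianExpMap g p u) (T v)).comp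
          (T : EuclideanSpace ℝ (Fin (k + 1)) →L[ℝ] EuclideanSpace ℝ (Fin (k + 1)))) :=
      h1.comp v (ContinuousLinearMap.hasMFDerivAt
        (f := (T : EuclideanSpace ℝ (Fin (k + 1)) →L[ℝ] EuclideanSpace ℝ (Fin (k + 1)))) (x := v))
    rw [h2.mfderiv, ContinuousLinearMap.comp_apply]
    exact congrArg _ (hT_single i)
  have hJexp : ∀ v, J v = Real.sqrt (Matrix.of fun i j ↦ g.val (expMap g.leviCivita p (T v))
      (mfderiv 𝓘(ℝ, EuclideanSpace ℝ (Fin (k + 1))) 𝓘(ℝ, EuclideanSpace ℝ (Fin (k + 1)))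
        (fun w : EuclideanSpace ℝ (Fin (k + 1)) ↦ expMap g.leviCivita p w) (T v) (bx i))
      (mfderiv 𝓘(ℝ, EuclideanSpace ℝ (Fin (k + 1))) 𝓘(ℝ, EuclideanSpace ℝ (Fin (k + 1)))
        (fun w : EuclideanSpace ℝ (Fin (k + 1)) ↦ expMap g.leviCivita p w) (T v) (bx j))).det := by
    intro v
    rw [hJ_def]
    simp only [hchain]
    rfl
  -- Bishop's monotone comparison per direction: `‖ξ‖ = 1`, `0 < u ≤ t`, `γ_{Tξ}|[0,t]` minimizing
  have hcrossJ : ∀ ξ : EuclideanSpace ℝ (Fin (k + 1)), ‖ξ‖ = 1 → ∀ u t : ℝ, 0 < u → u ≤ t →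
      IsMinimizingUpTo g hg p (T ξ) t →
      J (t • ξ) * t ^ k * Real.sin u ^ k ≤ J (u • ξ) * u ^ k * Real.sin t ^ k := by
    intro ξ hξ u t hu hut hmin
    have hunit : g.val p (T ξ) (T ξ) = 1 := by rw [hT, hξ, one_pow]
    have key := sqrt_det_gram_mfderiv_expMap_cross_le_of_unit g hg hc (by rw [hfinE]; omega)
      hRic' p (T ξ) hunit (hu.trans_le hut) hmin bx hu hut le_rfl
    rw [hfinE, Nat.add_sub_cancel] at key
    have ht' : T (t • ξ) = t • T ξ := map_smul T t ξ
    have hu' : T (u • ξ) = u • T ξ := map_smul T u ξ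
    rw [hJexp (t • ξ), hJexp (u • ξ)]
    rw [ht', hu']
    exact key
  -- §3 the domain `S = {v ∈ T⁻¹ ID(p), ‖v‖ ≤ R}` through the rationals
  set L : Set (EuclideanSpace ℝ (Fin (k + 1))) :=
    {v | ∃ q : ℚ, (1 : ℝ) < q ∧ IsMinimizingUpTo g hg p (T v) q} with hL_def
  have hLm : MeasurableSet L := by
    have hq_closed : ∀ q : ℚ, IsClosed {v : EuclideanSpace ℝ (Fin (k + 1)) |
        IsMinimizingUpTo g hg p (T v) q} := fun q ↦
      (isClosed_setOf_isMinimizingUpTo g le_rfl hg hc p).preimage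
        ((T : EuclideanSpace ℝ (Fin (k + 1)) →L[ℝ] EuclideanSpace ℝ (Fin (k + 1))).continuous.prodMk
          continuous_const :
          Continuous fun v : EuclideanSpace ℝ (Fin (k + 1)) ↦ (T v, ((q : ℚ) : ℝ)))
    have heq : L = ⋃ q : ℚ, ({v : EuclideanSpace ℝ (Fin (k + 1)) | (1 : ℝ) < q} ∩
        {v : EuclideanSpace ℝ (Fin (k + 1)) | IsMinimizingUpTo g hg p (T v) q}) := by
      ext v
      simp only [hL_def, mem_setOf_eq, mem_iUnion, mem_inter_iff]
    rw [heq]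
    exact MeasurableSet.iUnion fun q ↦ (MeasurableSet.const _).inter (hq_closed q).measurableSet
  have hLID : ∀ v, v ∈ L ↔ (T v : TangentSpace (𝓡 (k + 1)) p) ∈ injectivityDomain g hg p := by
    intro v
    constructor
    · rintro ⟨q, hq1, hq⟩
      exact ⟨q, hq1, hq⟩
    · rintro ⟨s, hs1, hs⟩
      obtain ⟨q, hq1, hqs⟩ := exists_rat_btwn hs1
      exact ⟨q, hq1, hs.mono hc (zero_le_one.trans hq1.le) hqs.le⟩
  set S : Set (EuclideanSpace ℝ (Fin (k + 1))) := {v | v ∈ L ∧ ‖v‖ ≤ R} with hS_def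
  have hSm : MeasurableSet S := by
    rw [hS_def, setOf_and]
    exact (hLm.inter (isClosed_le continuous_norm continuous_const).measurableSet)
  have hSeq : {v : EuclideanSpace ℝ (Fin (k + 1)) |
      (T v : TangentSpace (𝓡 (k + 1)) p) ∈ injectivityDomain g hg p ∧ ‖v‖ ≤ R} = S := by
    ext v
    exact ⟨fun h ↦ ⟨(hLID v).2 h.1, h.2⟩, fun h ↦ ⟨(hLID v).1 h.1, h.2⟩⟩
  rw [hSeq]
  -- §4 the ray comparison: for `1/2 ≤ s ≤ 1` and `s⁻¹ w ∈ S`: `w ∈ S` and `J(s⁻¹ w) ≤ 2ᵏ sᵏ J(w)`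
  have hray : ∀ s : ℝ, 1 / 2 ≤ s → s ≤ 1 → ∀ w : EuclideanSpace ℝ (Fin (k + 1)), s⁻¹ • w ∈ S →
      w ∈ S ∧ J (s⁻¹ • w) ≤ 2 ^ k * s ^ k * J w := by
    intro s hs1 hs2 w hw
    have hs0 : 0 < s := by linarith
    obtain ⟨⟨q, hq1, hq⟩, hnorm⟩ := hw
    have hwv : s • (s⁻¹ • w) = w := smul_inv_smul₀ hs0.ne' w
    -- `w ∈ S`
    have hq0 : (0 : ℝ) ≤ q := zero_le_one.trans hq1.le
    have h1 : IsMinimizingUpTo g hg p (T (s⁻¹ • w)) (s * q) :=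
      hq.mono hc (mul_nonneg hs0.le hq0) (mul_le_of_le_one_left hq0 hs2)
    have h2 : IsMinimizingUpTo g hg p (T w) q := by
      have h3 := (hTsmul s hs0 (s⁻¹ • w) q).2 h1
      rwa [hwv] at h3
    have hnorm_v : ‖s⁻¹ • w‖ = s⁻¹ * ‖w‖ := by
      rw [norm_smul, norm_inv, Real.norm_eq_abs, abs_of_pos hs0]
    have hnorm_w : ‖w‖ ≤ R := by
      have h4 : ‖w‖ ≤ ‖s⁻¹ • w‖ := by
        rw [hnorm_v]
        have : (1 : ℝ) ≤ s⁻¹ := one_le_inv_iff₀.2 ⟨hs0, hs2⟩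
        nlinarith [norm_nonneg w]
      exact h4.trans hnorm
    refine ⟨⟨⟨q, hq1, h2⟩, hnorm_w⟩, ?_⟩
    -- the Jacobian comparison along the ray
    by_cases hw0 : w = 0
    · rw [hw0, smul_zero]
      have h12 : (1 : ℝ) ≤ 2 ^ k * s ^ k := by
        rw [← mul_pow]
        exact one_le_pow₀ (by linarith)
      exact le_mul_of_one_le_left (hJ0 0) h12
    set u : ℝ := ‖w‖ with hu_def
    have hu0 : 0 < u := norm_pos_iff.2 hw0
    set t : ℝ := s⁻¹ * u with ht_def
    have ht0 : 0 < t := mul_pos (inv_pos.2 hs0) hu0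
    have hust : u = s * t := by rw [ht_def, ← mul_assoc, mul_inv_cancel₀ hs0.ne', one_mul]
    have hut : u ≤ t := by
      rw [hust]
      exact mul_le_of_le_one_left ht0.le hs2
    have htu2 : t / 2 ≤ u := by
      rw [hust]
      have : t / 2 = (1 / 2) * t := by ring
      rw [this]
      exact mul_le_mul_of_nonneg_right hs1 ht0.le
    have htR : t ≤ R := by
      have : t = ‖s⁻¹ • w‖ := by rw [hnorm_v]
      rw [this]
      exact hnorm
    have htπ2 : t ≤ Real.pi / 2 := htR.trans hRπ
    set ξ : EuclideanSpace ℝ (Fin (k + 1)) := u⁻¹ • w with hξ_def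
    have hξ : ‖ξ‖ = 1 := by
      rw [hξ_def, norm_smul, norm_inv, Real.norm_eq_abs, abs_of_pos hu0, ← hu_def,
        inv_mul_cancel₀ hu0.ne']
    have hw_eq : w = u • ξ := by rw [hξ_def, smul_inv_smul₀ hu0.ne']
    have hv_eq : s⁻¹ • w = t • ξ := by
      rw [hw_eq, smul_smul, ← ht_def]
    -- minimality of `γ_{Tξ}` up to `t` (indeed beyond)
    have hmin_t : IsMinimizingUpTo g hg p (T ξ) t := by
      have h5 : IsMinimizingUpTo g hg p (T (t • ξ)) q := by rw [← hv_eq]; exact hq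
      have h6 := (hTsmul t ht0 ξ q).1 h5
      exact h6.mono hc ht0.le (le_mul_of_one_le_right ht0.le hq1.le)
    have key := hcrossJ ξ hξ u t hu0 hut hmin_t
    -- `sin t ≤ 2 sin u` for `t/2 ≤ u ≤ t ≤ π/2`
    have hsin_u : 0 < Real.sin u :=
      Real.sin_pos_of_pos_of_lt_pi hu0 (by linarith [hut, htπ2, Real.pi_pos])
    have hsin_t0 : 0 ≤ Real.sin t :=
      Real.sin_nonneg_of_nonneg_of_le_pi ht0.le (by linarith [htπ2, Real.pi_pos])
    have hsin_le : Real.sin t ≤ 2 * Real.sin u := by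
      have h7 : Real.sin t = 2 * Real.sin (t / 2) * Real.cos (t / 2) := by
        rw [← Real.sin_two_mul]
        congr 1
        ring
      have h8 : 0 ≤ Real.sin (t / 2) :=
        Real.sin_nonneg_of_nonneg_of_le_pi (by linarith) (by linarith [htπ2, Real.pi_pos])
      have h9 : Real.sin (t / 2) ≤ Real.sin u :=
        Real.sin_le_sin_of_le_of_le_pi_div_two (by linarith [Real.pi_pos])
          (by linarith) htu2
      have h10 : Real.sin (t / 2) * Real.cos (t / 2) ≤ Real.sin (t / 2) :=
        mul_le_of_le_one_right h8 (Real.cos_le_one _)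
      nlinarith
    have h11 : Real.sin t ^ k ≤ (2 * Real.sin u) ^ k := pow_le_pow_left₀ hsin_t0 hsin_le k
    have h12 : J (t • ξ) * t ^ k * Real.sin u ^ k ≤
        (J (u • ξ) * u ^ k * 2 ^ k) * Real.sin u ^ k := by
      have h13 : J (u • ξ) * u ^ k * Real.sin t ^ k ≤ J (u • ξ) * u ^ k * (2 * Real.sin u) ^ k :=
        mul_le_mul_of_nonneg_left h11 (mul_nonneg (hJ0 _) (pow_nonneg hu0.le k))
      rw [mul_pow] at h13
      linarith [key, h13, show J (u • ξ) * u ^ k * (2 ^ k * Real.sin u ^ k) =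
        (J (u • ξ) * u ^ k * 2 ^ k) * Real.sin u ^ k by ring]
    have h14 : J (t • ξ) * t ^ k ≤ J (u • ξ) * u ^ k * 2 ^ k :=
      le_of_mul_le_mul_right h12 (pow_pos hsin_u k)
    have h15 : u ^ k = s ^ k * t ^ k := by rw [hust, mul_pow]
    have h16 : J (t • ξ) * t ^ k ≤ (2 ^ k * s ^ k * J (u • ξ)) * t ^ k := by
      rw [h15] at h14
      linarith [h14, show J (u • ξ) * (s ^ k * t ^ k) * 2 ^ k = (2 ^ k * s ^ k * J (u • ξ)) * t ^ k
        by ring]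
    rw [hv_eq, hw_eq]
    exact le_of_mul_le_mul_right h16 (pow_pos ht0 k)
  -- §5 for fixed `s ∈ [1/2, 1]`: dilation `w = s v` and the ray comparison
  have hstep : ∀ s ∈ Icc (1 / 2 : ℝ) 1,
      ∫⁻ v in S, ENNReal.ofReal (J v) * e (F (s • v)) ≤
        2 ^ (k + 1) * ∫⁻ w in S, ENNReal.ofReal (J w) * e (F w) := by
    intro s hs
    have hs0 : 0 < s := by linarith [hs.1]
    -- the integrand as a function of `w = s v`
    set Φ : EuclideanSpace ℝ (Fin (k + 1)) → ℝ≥0∞ := fun w ↦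
      {w | s⁻¹ • w ∈ S}.indicator (fun w ↦ ENNReal.ofReal (J (s⁻¹ • w)) * e (F w)) w with hΦ_def
    have hpre : MeasurableSet {w : EuclideanSpace ℝ (Fin (k + 1)) | s⁻¹ • w ∈ S} :=
      hSm.preimage (measurable_const_smul s⁻¹)
    have hΦm : Measurable Φ :=
      ((hJm.comp (measurable_const_smul s⁻¹)).mul (he.comp hFm)).indicator hpre
    have hΦv : ∀ v, S.indicator (fun v ↦ ENNReal.ofReal (J v) * e (F (s • v))) v = Φ (s • v) := by
      intro v
      have hinv : s⁻¹ • (s • v) = v := inv_smul_smul₀ hs0.ne' v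
      show _ = {w : EuclideanSpace ℝ (Fin (k + 1)) | s⁻¹ • w ∈ S}.indicator
        (fun w ↦ ENNReal.ofReal (J (s⁻¹ • w)) * e (F w)) (s • v)
      by_cases hv : v ∈ S
      · have hv' : s • v ∈ {w : EuclideanSpace ℝ (Fin (k + 1)) | s⁻¹ • w ∈ S} := by
          rw [mem_setOf_eq, hinv]
          exact hv
        rw [Set.indicator_of_mem hv, Set.indicator_of_mem hv']
        show ENNReal.ofReal (J v) * e (F (s • v)) = ENNReal.ofReal (J (s⁻¹ • (s • v))) * e (F (s • v))
        rw [hinv]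
      · have hv' : s • v ∉ {w : EuclideanSpace ℝ (Fin (k + 1)) | s⁻¹ • w ∈ S} := by
          rw [mem_setOf_eq, hinv]
          exact hv
        rw [Set.indicator_of_notMem hv, Set.indicator_of_notMem hv']
    have hΦle : ∀ w, Φ w ≤ S.indicator (fun w ↦ ENNReal.ofReal (2 ^ k * s ^ k * J w) * e (F w)) w := by
      intro w
      show {w : EuclideanSpace ℝ (Fin (k + 1)) | s⁻¹ • w ∈ S}.indicator
        (fun w ↦ ENNReal.ofReal (J (s⁻¹ • w)) * e (F w)) w ≤ _
      by_cases hw : s⁻¹ • w ∈ S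
      · obtain ⟨hwS, hJle⟩ := hray s hs.1 hs.2 w hw
        rw [Set.indicator_of_mem (show w ∈ {w | s⁻¹ • w ∈ S} from hw), Set.indicator_of_mem hwS]
        exact mul_le_mul_left (ENNReal.ofReal_le_ofReal hJle) _
      · rw [Set.indicator_of_notMem (show w ∉ {w | s⁻¹ • w ∈ S} from hw)]
        exact zero_le
    have hcs : ENNReal.ofReal |(s ^ (k + 1))⁻¹| * ENNReal.ofReal (2 ^ k * s ^ k) ≤ 2 ^ (k + 1) := by
      rw [abs_of_pos (inv_pos.2 (pow_pos hs0 _)), ← ENNReal.ofReal_mul (inv_pos.2 (pow_pos hs0 _)).le]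
      have h1 : (s ^ (k + 1))⁻¹ * (2 ^ k * s ^ k) = 2 ^ k / s := by
        have hsk : s ^ k ≠ 0 := pow_ne_zero _ hs0.ne'
        rw [pow_succ, mul_inv, div_eq_mul_inv]
        calc (s ^ k)⁻¹ * s⁻¹ * (2 ^ k * s ^ k) = 2 ^ k * s⁻¹ * ((s ^ k)⁻¹ * s ^ k) := by ring
          _ = 2 ^ k * s⁻¹ := by rw [inv_mul_cancel₀ hsk, mul_one]
      rw [h1, show (2 : ℝ≥0∞) ^ (k + 1) = ENNReal.ofReal (2 ^ (k + 1)) by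
        rw [ENNReal.ofReal_pow (by norm_num), ENNReal.ofReal_ofNat]]
      refine ENNReal.ofReal_le_ofReal ?_
      rw [div_le_iff₀ hs0, pow_succ]
      have h2 : (0 : ℝ) ≤ 2 ^ k := by positivity
      nlinarith [hs.1]
    calc ∫⁻ v in S, ENNReal.ofReal (J v) * e (F (s • v))
        = ∫⁻ v, S.indicator (fun v ↦ ENNReal.ofReal (J v) * e (F (s • v))) v :=
          (lintegral_indicator hSm _).symm
      _ = ∫⁻ v, Φ (s • v) := lintegral_congr hΦv
      _ = ENNReal.ofReal |(s ^ (k + 1))⁻¹| * ∫⁻ w, Φ w := lintegral_comp_smul_euclidean hΦm hs0.ne'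
      _ ≤ ENNReal.ofReal |(s ^ (k + 1))⁻¹| *
            ∫⁻ w, S.indicator (fun w ↦ ENNReal.ofReal (2 ^ k * s ^ k * J w) * e (F w)) w :=
          mul_le_mul_right (lintegral_mono hΦle) _
      _ = ENNReal.ofReal |(s ^ (k + 1))⁻¹| *
            (ENNReal.ofReal (2 ^ k * s ^ k) * ∫⁻ w in S, ENNReal.ofReal (J w) * e (F w)) := by
          rw [lintegral_indicator hSm]
          congr 1
          rw [← lintegral_const_mul' _ _ ENNReal.ofReal_ne_top]
          refine setLIntegral_congr_fun hSm fun w _ ↦ ?_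
          rw [ENNReal.ofReal_mul (mul_nonneg (pow_nonneg zero_le_two k) (pow_nonneg hs0.le k)),
            mul_assoc]
      _ = (ENNReal.ofReal |(s ^ (k + 1))⁻¹| * ENNReal.ofReal (2 ^ k * s ^ k)) *
            ∫⁻ w in S, ENNReal.ofReal (J w) * e (F w) := (mul_assoc _ _ _).symm
      _ ≤ 2 ^ (k + 1) * ∫⁻ w in S, ENNReal.ofReal (J w) * e (F w) := mul_le_mul_left hcs _
  -- §6 Tonelli in `(v, s)` and the `s`-integral of the constant bound
  have hpair : Measurable fun q : EuclideanSpace ℝ (Fin (k + 1)) × ℝ ↦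
      ENNReal.ofReal (J q.1) * e (F (q.2 • q.1)) :=
    (hJm.comp measurable_fst).mul (he.comp (hFm.comp (measurable_snd.smul measurable_fst)))
  have hinner : ∀ v, ENNReal.ofReal (J v) * ∫⁻ s in Icc (1 / 2 : ℝ) 1, e (F (s • v)) =
      ∫⁻ s in Icc (1 / 2 : ℝ) 1, ENNReal.ofReal (J v) * e (F (s • v)) := fun v ↦
    (lintegral_const_mul _ (he.comp (hFm.comp (measurable_id.smul measurable_const)))).symm
  calc ∫⁻ v in S, ENNReal.ofReal (J v) * ∫⁻ s in Icc (1 / 2 : ℝ) 1, e (F (s • v))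
      = ∫⁻ v in S, ∫⁻ s in Icc (1 / 2 : ℝ) 1, ENNReal.ofReal (J v) * e (F (s • v)) :=
        lintegral_congr hinner
    _ = ∫⁻ s in Icc (1 / 2 : ℝ) 1, ∫⁻ v in S, ENNReal.ofReal (J v) * e (F (s • v)) :=
        lintegral_lintegral_swap hpair.aemeasurable
    _ ≤ ∫⁻ s in Icc (1 / 2 : ℝ) 1, 2 ^ (k + 1) * ∫⁻ w in S, ENNReal.ofReal (J w) * e (F w) :=
        setLIntegral_mono' measurableSet_Icc hstep
    _ = 2 ^ (k + 1) * (∫⁻ w in S, ENNReal.ofReal (J w) * e (F w)) * volume (Icc (1 / 2 : ℝ) 1) :=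
        setLIntegral_const _ _
    _ = 2 ^ k * ∫⁻ w in S, ENNReal.ofReal (J w) * e (F w) := by
        rw [Real.volume_Icc, show (1 : ℝ) - 1 / 2 = 2⁻¹ by norm_num,
          ENNReal.ofReal_inv_of_pos two_pos, ENNReal.ofReal_ofNat]
        have h2 : (2 : ℝ≥0∞) ^ (k + 1) * 2⁻¹ = 2 ^ k := by
          rw [pow_succ, mul_assoc, ENNReal.mul_inv_cancel two_ne_zero ENNReal.ofNat_ne_top,
            mul_one]
        rw [mul_comm _ (2⁻¹ : ℝ≥0∞), ← mul_assoc, mul_comm (2⁻¹ : ℝ≥0∞), h2]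

/-! ### The ball on `M` in geodesic coordinates, and the half segment inequality against
`∫_{B̄_R(p)} e dVol_g` -/

/-- **Integrals over closed balls in geodesic coordinates**: on a connected Riemannian
`m`-manifold (`m ≥ 1`, modelled on `ℝᵐ`) with compact closed distance balls, for a linear
isometry `T : ℝᵐ ≃ (T_pM, g_p)`, measurable `e : M → [0, ∞]` and `R ≥ 0`,
`∫⁻_{B̄_R(p)} e dVol_g = ∫⁻_{v ∈ T⁻¹ID(p), ‖v‖ ≤ R} 𝒥(v) e(exp_p(T v)) dv`
(`lintegral_riemVolume_eq_lintegral_injectivityDomain` with `d(p, exp_p(T v)) = ‖v‖` on the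
injectivity domain, `edist_eq_of_isMinimizingUpTo`). [cite: Chavel2006, Thm. III.3.1] -/
theorem setLIntegral_closedBall_eq_lintegral_jacobian_mul (hg : g.IsRiemannian) (hm : 1 ≤ m)
    (hcpl : ∀ (x : M) (r : ℝ≥0), IsCompact {y : M | g.edist hg x y ≤ r}) (p : M)
    (T : EuclideanSpace ℝ (Fin m) ≃L[ℝ] EuclideanSpace ℝ (Fin m))
    (hT : ∀ v, g.val p (T v) (T v) = ‖v‖ ^ 2) {e : M → ℝ≥0∞} (he : Measurable e)
    {R : ℝ} (hR0 : 0 ≤ R) :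
    ∫⁻ y in {y : M | g.edist hg p y ≤ ENNReal.ofReal R}, e y ∂g.riemVolume =
      ∫⁻ v in {v : EuclideanSpace ℝ (Fin m) |
          (T v : TangentSpace (𝓡 m) p) ∈ injectivityDomain g hg p ∧ ‖v‖ ≤ R},
        ENNReal.ofReal (Real.sqrt (Matrix.det (Matrix.of fun i j : Fin m ↦
          g.val (riemannianExpMap g p (T v))
            (mfderiv 𝓘(ℝ, EuclideanSpace ℝ (Fin m)) (𝓡 m)
              (fun v : EuclideanSpace ℝ (Fin m) ↦ riemannianExpMap g p (T v)) v
              (EuclideanSpace.single i (1 : ℝ)))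
            (mfderiv 𝓘(ℝ, EuclideanSpace ℝ (Fin m)) (𝓡 m)
              (fun v : EuclideanSpace ℝ (Fin m) ↦ riemannianExpMap g p (T v)) v
              (EuclideanSpace.single j (1 : ℝ)))))) *
          e (riemannianExpMap g p (T v)) := by
  have hk1' : ((1 : ℕ∞) : ℕ∞ω) + 1 ≤ (∞ : ℕ∞ω) := by
    rw [show ((1 : ℕ∞) : ℕ∞ω) + 1 = 2 by norm_num]
    exact WithTop.coe_le_coe.2 le_top
  haveI : CovariantDerivative.ContMDiffCovariantDerivative g.leviCivita 1 :=
    ⟨g.isLocallyContMDiff_leviCivita_holds 1 hk1' univ isOpen_univ⟩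
  have hc : IsGeodesicallyComplete g.leviCivita :=
    isGeodesicallyComplete_of_isCompact_closedBall hg hcpl
  -- the closed ball is closed, hence measurable
  have hBm : MeasurableSet {y : M | g.edist hg p y ≤ ENNReal.ofReal R} :=
    (isClosed_le ((PseudoRiemannianMetric.continuous_edist hg).comp
      (continuous_const.prodMk continuous_id)) continuous_const).measurableSet
  have hIDm := (injectivityDomain_framing_core g hg hm hcpl p T hT).1
  have key := lintegral_riemVolume_eq_lintegral_injectivityDomain g hg hm hcpl p T hT
    (he.indicator hBm)
  rw [lintegral_indicator hBm] at key
  rw [key]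
  -- on the injectivity domain, `exp_p(T v) ∈ B̄_R(p) ↔ ‖v‖ ≤ R`
  have hball : ∀ v : EuclideanSpace ℝ (Fin m),
      (T v : TangentSpace (𝓡 m) p) ∈ injectivityDomain g hg p →
      (riemannianExpMap g p (T v) ∈ {y : M | g.edist hg p y ≤ ENNReal.ofReal R} ↔ ‖v‖ ≤ R) := by
    rintro v ⟨s, hs1, hs⟩
    have hmin : IsMinimizingUpTo g hg p (T v : TangentSpace (𝓡 m) p) 1 :=
      hs.mono hc zero_le_one hs1.le
    have hd : g.edist hg p (riemannianExpMap g p (T v)) = ENNReal.ofReal ‖v‖ := by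
      rw [edist_eq_of_isMinimizingUpTo hg hc hmin]
      exact congrArg ENNReal.ofReal (by rw [hT v, Real.sqrt_sq (norm_nonneg _)])
    rw [mem_setOf_eq, hd]
    exact ENNReal.ofReal_le_ofReal_iff hR0
  have hset : {v : EuclideanSpace ℝ (Fin m) |
      (T v : TangentSpace (𝓡 m) p) ∈ injectivityDomain g hg p ∧ ‖v‖ ≤ R} =
      {v : EuclideanSpace ℝ (Fin m) | ‖v‖ ≤ R} ∩
        {v : EuclideanSpace ℝ (Fin m) | (T v : TangentSpace (𝓡 m) p) ∈ injectivityDomain g hg p} := by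
    ext v
    simp only [mem_setOf_eq, mem_inter_iff]
    tauto
  rw [hset, ← setLIntegral_indicator (isClosed_le continuous_norm continuous_const).measurableSet]
  refine setLIntegral_congr_fun hIDm fun v hv ↦ ?_
  by_cases hvR : ‖v‖ ≤ R
  · rw [Set.indicator_of_mem ((hball v hv).2 hvR),
      Set.indicator_of_mem (show v ∈ {v : EuclideanSpace ℝ (Fin m) | ‖v‖ ≤ R} from hvR)]
  · rw [Set.indicator_of_notMem (fun h ↦ hvR ((hball v hv).1 h)),
      Set.indicator_of_notMem (show v ∉ {v : EuclideanSpace ℝ (Fin m) | ‖v‖ ≤ R} from hvR),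
      mul_zero]

/-- **The half segment inequality at a point against `∫_{B̄_R(p)} e dVol_g`**
(Cheeger–Colding 1996, Thm. 2.11, base-point half): under `Ric ≥ (m - 1) g`, `m ≥ 2`, on a
connected manifold with compact closed distance balls, for `0 ≤ R ≤ π/2` and measurable
`e : M → [0, ∞]`,
`∫⁻_{v ∈ T⁻¹ID(p), ‖v‖ ≤ R} 𝒥(v) (∫⁻_{s ∈ [1/2,1]} e(exp_p(T(sv))) ds) dv ≤ 2^{m-1} ∫⁻_{B̄_R(p)} e dVol_g`
(`lintegral_jacobian_mul_lintegral_halfSegment_le` and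
`setLIntegral_closedBall_eq_lintegral_jacobian_mul`).
[cite: CheegerColding1996, Thm. 2.11 (proof)] [cite: Chavel2006, Prop. III.4.1] -/
theorem lintegral_jacobian_mul_lintegral_halfSegment_le_setLIntegral_closedBall
    (hg : g.IsRiemannian) (hm : 2 ≤ m)
    (hcpl : ∀ (x : M) (r : ℝ≥0), IsCompact {y : M | g.edist hg x y ≤ r})
    (hRic : ∀ (x : M) (w : TangentSpace (𝓡 m) x), ((m : ℝ) - 1) * g.val x w w ≤ g.ricci x w w)
    (p : M) (T : EuclideanSpace ℝ (Fin m) ≃L[ℝ] EuclideanSpace ℝ (Fin m))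
    (hT : ∀ v, g.val p (T v) (T v) = ‖v‖ ^ 2) {e : M → ℝ≥0∞} (he : Measurable e)
    {R : ℝ} (hR0 : 0 ≤ R) (hRπ : R ≤ Real.pi / 2) :
    ∫⁻ v in {v : EuclideanSpace ℝ (Fin m) |
        (T v : TangentSpace (𝓡 m) p) ∈ injectivityDomain g hg p ∧ ‖v‖ ≤ R},
      ENNReal.ofReal (Real.sqrt (Matrix.det (Matrix.of fun i j : Fin m ↦
          g.val (riemannianExpMap g p (T v))
            (mfderiv 𝓘(ℝ, EuclideanSpace ℝ (Fin m)) (𝓡 m)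
              (fun v : EuclideanSpace ℝ (Fin m) ↦ riemannianExpMap g p (T v)) v
              (EuclideanSpace.single i (1 : ℝ)))
            (mfderiv 𝓘(ℝ, EuclideanSpace ℝ (Fin m)) (𝓡 m)
              (fun v : EuclideanSpace ℝ (Fin m) ↦ riemannianExpMap g p (T v)) v
              (EuclideanSpace.single j (1 : ℝ)))))) *
        ∫⁻ s in Icc (1 / 2 : ℝ) 1, e (riemannianExpMap g p (T (s • v))) ≤
      2 ^ (m - 1) * ∫⁻ y in {y : M | g.edist hg p y ≤ ENNReal.ofReal R}, e y ∂g.riemVolume := by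
  rw [setLIntegral_closedBall_eq_lintegral_jacobian_mul g hg (by omega) hcpl p T hT he hR0]
  exact lintegral_jacobian_mul_lintegral_halfSegment_le g hg hm hcpl hRic p T hT he hRπ

end Literature.Geometry.Riemannian

end
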